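import Summits.CriticalPhenomena.CardyFormulaZ2.Theorems.ParafermionPrecompact.Negative.ParafermionPrecompactFalseOfBulkNondegenerate

/-!
# As typed, `ParafermionPrecompact` ⇒ `WeakHolomorphy`: the weak-holomorphy sums are controlled
# by the bulk size of the observable

Refuter `refuter-cdisprove-stmt-CriticalPhenomena-11293-0` (cdisprove unit), file 3 of 3.

* `norm_weakSum_le` (quantitative, deterministic counting at density `2/δ²`): if at mesh
  `δ ∈ (0,1]` every genuine medial vertex with point in `tsupport φ ⊆ closedBall 0 R` has
  `‖F_δ‖ ≤ c δ^{1/3}`, then `‖δ^{5/3} Σᶠ_z F_δ(z) ∂̄φ(z_δ)‖ ≤ 2(2R+5)² ‖Dφ‖_∞ · c`.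
* `weakSum_tendsto_zero_of_vanishesOn`: the degenerate normalisation kills the X1 sums; hence
  `parafermionPrecompact_false_of_not_weakHolomorphy : ¬ WeakHolomorphy → ¬ ParafermionPrecompact`
  — AS TYPED the rank-2 "open-problem" crux X1 is a corollary of the rank-3 crux X2 (second symptom
  of the missing edge guards).
* `weakSum_bounded_of_clauseBoundEdges`: under the REPAIRED clause (i) (`‖F_δ‖ ≤ Cδ^{1/3}` on genuine
  medial vertices) the X1 sums are eventually BOUNDED — a-priori information for the prover of
  `WeakHolomorphy` (stmt-CriticalPhenomena-11292).
-/

noncomputable section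

namespace Summit.CriticalPhenomena.CardyFormulaZ2.Theorems.ParafermionPrecompact.Negative

open Literature.Probability.LatticeModels Literature.Probability.RandomPlanarGeometry
open Literature.Probability.Percolation MeasureTheory Filter Set
open scoped Topology

/-! ## §6 As typed, X2 ⇒ X1: the weak-holomorphy sums are controlled by `sup_K δ^{-1/3}‖F_δ‖` -/

/-- The finite set of edges `{x, x + e_i}` with `x` in the box `[-n, n]²`. [folklore] -/
def edgeBox (n : ℕ) : Finset MedialVertex :=
  ((Fintype.piFinset fun _ : Fin 2 => Finset.Icc (-(n:ℤ)) n) ×ˢ (Finset.univ : Finset (Fin 2))).image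
    fun p => s(p.1, p.1 + Pi.single p.2 1)

/-- The edge box has at most `2 (2n+1)²` elements. [folklore] -/
theorem card_edgeBox_le (n : ℕ) : ((edgeBox n).card : ℝ) ≤ 2 * (2 * n + 1) ^ 2 := by
  have h1 : (edgeBox n).card ≤
      ((Fintype.piFinset fun _ : Fin 2 => Finset.Icc (-(n:ℤ)) n) ×ˢ (Finset.univ : Finset (Fin 2))).card :=
    Finset.card_image_le
  rw [Finset.card_product, Fintype.card_piFinset, Finset.prod_const, Finset.card_univ,
    Fintype.card_fin, Int.card_Icc] at h1
  have h2 : ((n:ℤ) + 1 - -(n:ℤ)).toNat = 2 * n + 1 := by omega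
  rw [h2] at h1
  have h3 : ((edgeBox n).card : ℝ) ≤ (((2 * n + 1) ^ 2 * 2 : ℕ) : ℝ) := by exact_mod_cast h1
  calc ((edgeBox n).card : ℝ) ≤ (((2 * n + 1) ^ 2 * 2 : ℕ) : ℝ) := h3
    _ = 2 * (2 * n + 1) ^ 2 := by push_cast; ring

/-- Edges based in the box `[-n, n]²` belong to the edge box. [folklore] -/
theorem mem_edgeBox {n : ℕ} {x : Site 2} (hx : ∀ j, |x j| ≤ n) (i : Fin 2) :
    s(x, x + Pi.single i 1) ∈ edgeBox n := by
  refine Finset.mem_image.2 ⟨(x, i), ?_, rfl⟩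
  rw [Finset.mem_product]
  refine ⟨Fintype.mem_piFinset.2 fun j => Finset.mem_Icc.2 ⟨?_, ?_⟩, Finset.mem_univ _⟩
  · have := hx j; rw [abs_le] at this; exact this.1
  · have := hx j; rw [abs_le] at this; exact this.2

/-- Coordinates of a unit vector are `0` or `1`. [folklore] -/
theorem single_apply_mem (i j : Fin 2) : (Pi.single i (1:ℤ) : Site 2) j = 0 ∨ (Pi.single i (1:ℤ) : Site 2) j = 1 := by
  by_cases h : j = i
  · subst h; simp
  · simp [h]

/-- Real part of the medial point of `{x, x + e_i}`. [folklore] -/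
theorem medialPoint_edge_re (δ : ℝ) (x : Site 2) (i : Fin 2) :
    (medialPoint δ s(x, x + Pi.single i 1)).re = δ * x 0 + δ * (Pi.single i (1:ℤ) : Site 2) 0 / 2 := by
  simp [medialPoint_mk, meshPoint_re]
  ring

/-- Imaginary part of the medial point of `{x, x + e_i}`. [folklore] -/
theorem medialPoint_edge_im (δ : ℝ) (x : Site 2) (i : Fin 2) :
    (medialPoint δ s(x, x + Pi.single i 1)).im = δ * x 1 + δ * (Pi.single i (1:ℤ) : Site 2) 1 / 2 := by
  simp [medialPoint_mk, meshPoint_im]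
  ring

/-- Sites of an edge whose midpoint lies in `closedBall 0 R` have coordinates `≤ R/δ + 1/2`. [folklore] -/
theorem abs_coord_le_of_medialPoint_mem {δ R : ℝ} (hδ : 0 < δ) {x : Site 2} {i : Fin 2}
    (h : medialPoint δ s(x, x + Pi.single i 1) ∈ Metric.closedBall (0:ℂ) R) (j : Fin 2) :
    (|x j| : ℝ) ≤ R / δ + 1 / 2 := by
  rw [Metric.mem_closedBall, dist_zero_right] at h
  set m := medialPoint δ s(x, x + Pi.single i 1) with hm
  have hcoord : ∃ t : ℝ, (t = 0 ∨ t = 1) ∧ |δ * x j + δ * t / 2| ≤ R := by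
    fin_cases j
    · refine ⟨((Pi.single i (1:ℤ) : Site 2) 0 : ℝ), ?_, ?_⟩
      · rcases single_apply_mem i 0 with h0 | h0 <;> simp [h0]
      · have := Complex.abs_re_le_norm m
        rw [hm, medialPoint_edge_re] at this
        simpa using this.trans h
    · refine ⟨((Pi.single i (1:ℤ) : Site 2) 1 : ℝ), ?_, ?_⟩
      · rcases single_apply_mem i 1 with h0 | h0 <;> simp [h0]
      · have := Complex.abs_im_le_norm m
        rw [hm, medialPoint_edge_im] at this
        simpa using this.trans h
  obtain ⟨t, ht, hb⟩ := hcoord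
  have ht' : |δ * t / 2| ≤ δ / 2 := by
    rcases ht with rfl | rfl
    · simp only [mul_zero, zero_div, abs_zero]; positivity
    · rw [mul_one, abs_of_nonneg (by positivity)]
  have h1 : |δ * x j| ≤ R + δ / 2 := by
    have := abs_sub_le (δ * x j + δ * t / 2) (δ * t / 2) 0
    calc |δ * ↑(x j)| = |(δ * x j + δ * t / 2) - δ * t / 2| := by ring_nf
      _ ≤ |δ * x j + δ * t / 2| + |δ * t / 2| := abs_sub _ _
      _ ≤ R + δ / 2 := add_le_add hb ht'
  rw [abs_mul, abs_of_pos hδ] at h1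
  rw [div_add_div _ _ hδ.ne' two_ne_zero, le_div_iff₀ (by positivity)]
  nlinarith


/-- The `∂̄`-weight of the weak-holomorphy sum of `WeakHolomorphy`:
`(∂φ(w)·1 + i ∂φ(w)·i)/2 = ∂̄φ(w)`. [folklore] -/
def dbarWeight (φ : ℂ → ℂ) (w : ℂ) : ℂ := (fderiv ℝ φ w 1 + Complex.I * fderiv ℝ φ w Complex.I) / 2

/-- `‖∂̄φ(w)‖ ≤ sup ‖Dφ‖`. [folklore] -/
theorem norm_dbarWeight_le {φ : ℂ → ℂ} {M : ℝ} (hM : ∀ w, ‖fderiv ℝ φ w‖ ≤ M) (w : ℂ) :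
    ‖dbarWeight φ w‖ ≤ M := by
  unfold dbarWeight
  have h1 : ‖fderiv ℝ φ w 1‖ ≤ M :=
    ((fderiv ℝ φ w).le_opNorm 1).trans (by simpa using hM w)
  have h2 : ‖Complex.I * fderiv ℝ φ w Complex.I‖ ≤ M := by
    rw [norm_mul, Complex.norm_I, one_mul]
    exact ((fderiv ℝ φ w).le_opNorm _).trans (by simpa using hM w)
  rw [norm_div, Complex.norm_two]
  linarith [norm_add_le (fderiv ℝ φ w 1) (Complex.I * fderiv ℝ φ w Complex.I)]

/-- Off the topological support of `φ` the weight vanishes. [folklore] -/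
theorem dbarWeight_eq_zero {φ : ℂ → ℂ} {w : ℂ} (hw : w ∉ tsupport φ) : dbarWeight φ w = 0 := by
  have : fderiv ℝ φ w = 0 := Function.notMem_support.1 fun h => hw (support_fderiv_subset ℝ h)
  simp [dbarWeight, this]

/-- **Quantitative control of the weak-holomorphy sum by the bulk size of the observable.**  If at
mesh `δ ∈ (0,1]` every GENUINE medial vertex whose point lies in `tsupport φ ⊆ closedBall 0 R`
has `‖F_δ‖ ≤ c δ^{1/3}`, then `‖δ^{5/3} Σᶠ_z F_δ(z) ∂̄φ(z_δ)‖ ≤ 2 (2R+5)² ‖Dφ‖_∞ · c`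
(`2/δ²`-density of medial vertices).  With `c = ε → 0` this is X2(typed) ⇒ X1; with `c = C` of the
repaired clause (i) it is BOUNDEDNESS of the X1 sums — an a-priori lemma for the prover of
`WeakHolomorphy`. [folklore] -/
theorem norm_weakSum_le {Λ : ℝ → DiscreteDobrushin} {φ : ℂ → ℂ} {M R c δ : ℝ}
    (hM : ∀ w, ‖fderiv ℝ φ w‖ ≤ M) (hM0 : 0 ≤ M) (hR : tsupport φ ⊆ Metric.closedBall 0 R)
    (hR0 : 0 ≤ R) (hc : 0 ≤ c) (hδ : 0 < δ) (hδ1 : δ ≤ 1)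
    (hF : ∀ z : MedialVertex, z ∈ (zdGraph 2).edgeSet → medialPoint δ z ∈ tsupport φ →
      ‖F Λ δ z‖ ≤ c * δ ^ ((1:ℝ) / 3)) :
    ‖((δ ^ ((5:ℝ) / 3) : ℝ) : ℂ) * ∑ᶠ z : MedialVertex, F Λ δ z * dbarWeight φ (medialPoint δ z)‖
      ≤ 2 * (2 * R + 5) ^ 2 * M * c := by
  set n : ℕ := ⌈R / δ⌉₊ + 1 with hn_def
  have hsupp : Function.support (fun z => F Λ δ z * dbarWeight φ (medialPoint δ z)) ⊆
      ↑(edgeBox n) := by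
    intro z hz
    rw [Function.mem_support] at hz
    have hzE : z ∈ (zdGraph 2).edgeSet := by
      by_contra h
      exact hz (by rw [F_eq_zero_of_not_mem_edgeSet Λ δ h, zero_mul])
    have hzK : medialPoint δ z ∈ tsupport φ := by
      by_contra h
      exact hz (by rw [dbarWeight_eq_zero h, mul_zero])
    obtain ⟨x, i, rfl⟩ := exists_eq_mk_add_single hzE
    refine mem_edgeBox (fun j => ?_) i
    have hj := abs_coord_le_of_medialPoint_mem hδ (hR hzK) j
    have hn : R / δ + 1 / 2 ≤ (n : ℝ) := by
      rw [hn_def]; push_cast; linarith [Nat.le_ceil (R / δ)]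
    exact_mod_cast hj.trans hn
  rw [finsum_eq_sum_of_support_subset _ hsupp]
  have hterm : ∀ z ∈ edgeBox n,
      ‖F Λ δ z * dbarWeight φ (medialPoint δ z)‖ ≤ c * δ ^ ((1:ℝ) / 3) * M := by
    intro z _
    rw [norm_mul]
    by_cases hzK : medialPoint δ z ∈ tsupport φ
    · by_cases hzE : z ∈ (zdGraph 2).edgeSet
      · exact mul_le_mul (hF z hzE hzK) (norm_dbarWeight_le hM _) (norm_nonneg _) (by positivity)
      · rw [F_eq_zero_of_not_mem_edgeSet Λ δ hzE, norm_zero, zero_mul]; positivity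
    · rw [dbarWeight_eq_zero hzK, norm_zero, mul_zero]; positivity
  have hsum : ‖∑ z ∈ edgeBox n, F Λ δ z * dbarWeight φ (medialPoint δ z)‖ ≤
      (edgeBox n).card * (c * δ ^ ((1:ℝ) / 3) * M) := by
    refine (norm_sum_le _ _).trans ?_
    have := Finset.sum_le_card_nsmul _ _ _ hterm
    rwa [nsmul_eq_mul] at this
  have hcard := card_edgeBox_le n
  have hnδ : δ * (2 * n + 1) ≤ 2 * R + 5 := by
    have : (n : ℝ) ≤ R / δ + 2 := by
      rw [hn_def]; push_cast; linarith [Nat.ceil_lt_add_one (div_nonneg hR0 hδ.le)]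
    calc δ * (2 * n + 1) ≤ δ * (2 * (R / δ + 2) + 1) := by gcongr
      _ = 2 * R + 5 * δ := by field_simp; ring
      _ ≤ 2 * R + 5 := by linarith
  have hpow : δ ^ ((5:ℝ) / 3) * δ ^ ((1:ℝ) / 3) = δ ^ 2 := by
    rw [← Real.rpow_add hδ]; norm_num
  rw [norm_mul, Complex.norm_real, Real.norm_eq_abs, abs_of_nonneg (Real.rpow_nonneg hδ.le _)]
  calc δ ^ ((5:ℝ) / 3) * ‖∑ z ∈ edgeBox n, F Λ δ z * dbarWeight φ (medialPoint δ z)‖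
      ≤ δ ^ ((5:ℝ) / 3) * ((edgeBox n).card * (c * δ ^ ((1:ℝ) / 3) * M)) := by gcongr
    _ ≤ δ ^ ((5:ℝ) / 3) * ((2 * (2 * n + 1) ^ 2) * (c * δ ^ ((1:ℝ) / 3) * M)) := by gcongr
    _ = (δ ^ ((5:ℝ) / 3) * δ ^ ((1:ℝ) / 3)) * (2 * (2 * n + 1) ^ 2) * c * M := by ring
    _ = 2 * (δ * (2 * n + 1)) ^ 2 * M * c := by rw [hpow]; ring
    _ ≤ 2 * (2 * R + 5) ^ 2 * M * c := by gcongr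

/-- **The degenerate normalisation kills the weak-holomorphy sums** (per instance): if
`δ^{-1/3} F_δ → 0` uniformly on `tsupport φ` then `δ^{5/3} Σᶠ_z F_δ(z) ∂̄φ(z_δ) → 0` — the conclusion
of the sibling crux `WeakHolomorphy` for `(D, Λ, φ)`.  Hence, AS TYPED, X2 ⇒ X1 (packaged below in
the negative shape `¬X1 → ¬X2`). [folklore] -/
theorem weakSum_tendsto_zero_of_vanishesOn {Λ : ℝ → DiscreteDobrushin} {φ : ℂ → ℂ}
    (hφ : ContDiff ℝ (⊤ : ℕ∞) φ) (hsupp : HasCompactSupport φ) (hV : VanishesOn Λ (tsupport φ)) :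
    Tendsto (fun δ : ℝ => ((δ ^ ((5:ℝ) / 3) : ℝ) : ℂ) *
      ∑ᶠ z : MedialVertex, F Λ δ z * dbarWeight φ (medialPoint δ z)) (𝓝[>] 0) (𝓝 0) := by
  obtain ⟨M, hM⟩ := (hφ.continuous_fderiv (by simp)).bounded_above_of_compact_support
    (hsupp.fderiv (𝕜 := ℝ))
  have hM0 : 0 ≤ M := (norm_nonneg _).trans (hM 0)
  obtain ⟨R, hR⟩ := hsupp.isCompact.isBounded.subset_closedBall 0
  have hR' : tsupport φ ⊆ Metric.closedBall 0 (max R 0) :=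
    hR.trans (Metric.closedBall_subset_closedBall (le_max_left _ _))
  rw [Metric.tendsto_nhds]
  intro ε hε
  set A : ℝ := 2 * (2 * max R 0 + 5) ^ 2 * M + 1 with hA_def
  have hA : 0 < A := by positivity
  filter_upwards [hV (ε / (2 * A)) (by positivity), Ioo_mem_nhdsGT one_pos] with δ hδ hδI
  rw [dist_zero_right]
  have key := norm_weakSum_le (Λ := Λ) hM hM0 hR' (le_max_right _ _)
    (by positivity : 0 ≤ ε / (2 * A)) hδI.1 hδI.2.le (fun z _ hz => hδ z hz)
  have hlt : 2 * (2 * max R 0 + 5) ^ 2 * M < 2 * A := by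
    rw [hA_def]; nlinarith [sq_nonneg (2 * max R 0 + 5)]
  calc _ ≤ 2 * (2 * max R 0 + 5) ^ 2 * M * (ε / (2 * A)) := key
    _ = (2 * (2 * max R 0 + 5) ^ 2 * M) / (2 * A) * ε := by ring
    _ < 1 * ε := by
        gcongr
        rwa [div_lt_one (by positivity)]
    _ = ε := one_mul ε

/-- **A-priori boundedness of the X1 sums under the REPAIRED clause (i)** (prover information for
`WeakHolomorphy`): if `‖F_δ‖ ≤ C δ^{1/3}` on the genuine medial vertices of `tsupport φ` eventually,
then `δ^{5/3} Σᶠ_z F_δ(z) ∂̄φ(z_δ)` is eventually bounded. [folklore] -/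
theorem weakSum_bounded_of_clauseBoundEdges {Λ : ℝ → DiscreteDobrushin} {φ : ℂ → ℂ}
    (hφ : ContDiff ℝ (⊤ : ℕ∞) φ) (hsupp : HasCompactSupport φ)
    (hB : ClauseBoundEdges Λ (tsupport φ)) :
    ∃ B : ℝ, ∀ᶠ δ in 𝓝[>] 0,
      ‖((δ ^ ((5:ℝ) / 3) : ℝ) : ℂ) * ∑ᶠ z : MedialVertex, F Λ δ z * dbarWeight φ (medialPoint δ z)‖
        ≤ B := by
  obtain ⟨M, hM⟩ := (hφ.continuous_fderiv (by simp)).bounded_above_of_compact_support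
    (hsupp.fderiv (𝕜 := ℝ))
  have hM0 : 0 ≤ M := (norm_nonneg _).trans (hM 0)
  obtain ⟨R, hR⟩ := hsupp.isCompact.isBounded.subset_closedBall 0
  have hR' : tsupport φ ⊆ Metric.closedBall 0 (max R 0) :=
    hR.trans (Metric.closedBall_subset_closedBall (le_max_left _ _))
  obtain ⟨C, hC⟩ := hB
  refine ⟨2 * (2 * max R 0 + 5) ^ 2 * M * max C 0, ?_⟩
  filter_upwards [hC, Ioo_mem_nhdsGT one_pos] with δ hδ hδI
  refine norm_weakSum_le (Λ := Λ) hM hM0 hR' (le_max_right _ _) (le_max_right _ _) hδI.1 hδI.2.le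
    (fun z hzE hz => (hδ z hzE hz).trans ?_)
  gcongr
  · exact Real.rpow_nonneg hδI.1.le _
  · exact le_max_left _ _

/-- **As typed, X2 ⇒ X1** in the negative shape `¬X1 → ¬X2`: a certified non-zero weak limit of
the discrete `∂̄` (the route's own kill criterion for `WeakHolomorphy`) would ALSO refute the typed
`ParafermionPrecompact` — the rank-2 "open-problem" crux is a COROLLARY of the rank-3 crux as
typed (second symptom of the missing edge guards; under the repaired clause (i) only
`weakSum_bounded_of_clauseBoundEdges` survives). [folklore] -/
theorem parafermionPrecompact_false_of_not_weakHolomorphy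
    (h : ¬ Theses.CardySusyWard.WeakHolomorphy) : ¬ Theses.CardySusyWard.ParafermionPrecompact := by
  intro hP
  have hV := parafermionPrecompact_iff_vanishing.1 hP
  exact h fun D Λ h1 h2 h3 h4 h5 h6 φ hφ hsupp hsub =>
    weakSum_tendsto_zero_of_vanishesOn hφ hsupp (hV D Λ ⟨h1, h2, h3, h4, h5, h6⟩ _ hsupp.isCompact hsub)

end Summit.CriticalPhenomena.CardyFormulaZ2.Theorems.ParafermionPrecompact.Negative

end
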